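import Summits.BirchSwinnertonDyer.BirchSwinnertonDyer.Theorems.KatoDescentTamePotSupersingularCartanMuRoadDoorsTprimeFive
import Summits.BirchSwinnertonDyer.BirchSwinnertonDyer.Theorems.KatoDescentTamePotSupersingularTameUpperUnitTwistRecordsFlat27
import Summits.BirchSwinnertonDyer.BirchSwinnertonDyer.Theorems.KatoDescentTamePotSupersingularTameUpperUnitTwistRecordsFlat28
import Summits.BirchSwinnertonDyer.BirchSwinnertonDyer.Theorems.KatoDescentTamePotSupersingularTameUpperUnitTwistRecordsFlat81
import Summits.BirchSwinnertonDyer.BirchSwinnertonDyer.Theorems.KatoDescentTamePotSupersingularTameUpperUnitTwistRecordsSharp29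
import Summits.BirchSwinnertonDyer.BirchSwinnertonDyer.Theorems.KatoDescentTamePotSupersingularTameUpperUnitTwistRecordTools
import Summits.BirchSwinnertonDyer.BirchSwinnertonDyer.Theorems.KatoDescentTamePotSupersingularTameUpperUnitTwistRecordToolsTprime
import Summits.BirchSwinnertonDyer.BirchSwinnertonDyer.Theorems.Rank1ResidualIntModelReduction
import Summits.BirchSwinnertonDyer.Rank1Residual.Supersingular.CountPointsFast
import Summits.BirchSwinnertonDyer.Rank1Residual.Supersingular.IntModelMinimalityKrausTwoMore
import Summits.BirchSwinnertonDyer.Rank1Residual.Additive.X4ThreeResCertKernel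
import Summits.BirchSwinnertonDyer.Rank1Residual.X11b.CertificateCheckBridge
import Summits.BirchSwinnertonDyer.Rank1Residual.X11b.ChaPairsMinimality
import HarnessLib

/-!
# Route `KatoDescentTamePotSupersingular` (rung K8, sub-rung B4 (t′), cell `bsd-potss`): per-row U₀ RECORDS BY THE μ-ROAD at `p = 5` —
# the UPPER half `ord₅ #Ш(E) ≤ ord₅ #Ш(E)_an` (`MissingUpperBoundAt E 5`, U₀-ns node 19202 → parent 19982) from statement (A) at the row
# (conjA-anchor g12's `5Nn` / `5S4` chains) ∘ the fine-Selmer port of Kato 14.5 (3), part 02: 93100bb1, 100575h1, 100575k1, 100575q1, 101925o1, 101925r1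
# (seat `bsd-potss-k8t-c4` g17; companion of `…TameConjAFiveRecordsNN`; `--supports stmt-BirchSwinnertonDyer-19982 --as helper`)

HONEST FRAMING. THEOREMS ONLY (no definition, no named fact, no `sorry`); PER ROW — NOT a class theorem; nothing is booked; items 19202 /
19982 stay OPEN at class level (their class-wide open inputs are the zeta crux 24439 `TameKatoZetaIndivisible` and the lower half of the
residual 19984; the μ-road is a SECOND, lemma-level road on the rows where conjA-anchor g12's unit norm-index census reads `CHAIN:PASS`);
BSD is proved for NO curve here. ROAD (this seat's route-free doors `CartanMuRoadDoorsTprimeFive`, the `p = 5` twin of g16's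
`CartanMuRoadRealDoorsTprime`): `MissingUpperBoundAt E 5 ⟸` NAMED FACTS Kato's fine-Selmer reading of 14.5 (3) (`hKatoA`), GZK (`hGZK`),
modularity (`hmod`), Coates–Sujatha Thm. 3.4 (`hCS`) `+` Cremona's `r_an = 0` (`hr`, displayed) `+` KERNEL `Addv E 5`, `SubTprime E 5`,
`E[5]` irreducible (REUSED from the unit-twist record files of k8t-c4 g14–g16, imported; proved here for the one row without a record,
100575q1) `+` the DISPLAYED image basis data and `μ`-hypotheses of the companion (A) record (`5Nn`: seven leaves of degrees 24, 12, 12, 6, 6,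
6, 3; `5S4`: six leaves of degrees 24, 24, 24, 24, 12, 12), whose numerical verdicts (conjA-anchor g12 kit j307989, ROW-STATUS-conjA-anchor-g12.tsv;
GRH for degree-24 class numbers unless certified) are quoted in each section header. 54 of the 55 rows already hold a unit-twist U₀ record
(`TameUpperUnitTwistRecords.missingUpperBoundAt_g<label>_5`, ONE rank-one Heegner twist with `5 ∤ #Ш_an`); for them this is a second road
on disjoint displayed inputs. For 100575q1 (♯, `5Nn`; every Heegner twist with `N·d² ≤ 1.2·10¹⁴` `ellrank`-exhausted, k8t-c4 g16 census
v12) it is the first.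

References: [Kato2004Asterisque] Thm. 12.5 (3), 14.5 (3); [CoatesSujatha2005] Thm. 3.4; [Serre1972] §2.2; [Zywina2015] §1.3; [Mazur1978] §6;
[IrelandRosen1990] §5, §8; [SilvermanAEC2009] VII; [Kraus1989]; [Cremona2006] Table 1.
-/

set_option autoImplicit false
set_option linter.dupNamespace false

noncomputable section

open scoped Classical NumberField Matrix
open WeierstrassCurve Field IntermediateField
  Literature.NumberTheory.EllipticCurves Literature.NumberTheory.EllipticCurves.Rank1Residual
  Literature.NumberTheory.EllipticCurves.Rank1Residual.Typed
  Literature.NumberTheory.EllipticCurves.Rank1Residual.X11RankOneCertificates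
  Literature.NumberTheory.GaloisRepresentations Literature.NumberTheory.SerreUniformity
  Literature.NumberTheory.EllipticCurves.Zywina2015G9 Literature.NumberTheory.IwasawaTheory
  Summit.BirchSwinnertonDyer.BirchSwinnertonDyer.Rank1Residual.IntModel
  Summit.BirchSwinnertonDyer.Rank1Residual Summit.BirchSwinnertonDyer.Rank1Residual.Additive
  Summit.BirchSwinnertonDyer.Rank1Residual.Supersingular Summit.BirchSwinnertonDyer.Rank1Residual.X11b
  Summit.BirchSwinnertonDyer.BirchSwinnertonDyer.Theorems

namespace Summit.BirchSwinnertonDyer.BirchSwinnertonDyer.Theorems.TameConjAFiveRecords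

/-! ### `93100bb1` @ `p = 5` — `N = 93100 = 2^2·5^2·7^2·19`; Cremona: `r_an = 0`; (t′) at `5`: `e = 6` (Kodaira II or II*);
mod-`5` image normaliser of a NON-split Cartan `C_ns⁺(5)` (LMFDB `5Nn`) (census HOME/k8t-c4/KT-19413-anchor-census-g4.tsv / LMFDB); ♯ row (one Tamagawa carrier `q ∥ N` with `5 ∣ c_q`); U₀ unit-twist record and kernel lemmas in `…RecordsSharp29`.
conjA-anchor g12 unit norm-index census (kit j307989, GRH for degree-24 class numbers unless CERT): `QP<s>=PASS:UNIT(s=2);B1<x^12,s>=PASS:UNIT(s=2);B1p<x^6 s>=PASS:UNIT(s=2);S<x^3>=PASS:UNIT(s=3);B2<x^6,s>=PASS:UNIT(s=2);B2p<x^6,x^3 s>=PASS:UNIT(s=2);B3<x^3,s>=PASS:UNIT(s=2)` ⇒ `CHAIN:PASS`. -/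

/-- **RECORD — UPPER half `ord₅ #Ш(E) ≤ ord₅ #Ш(E)_an` for `E = 93100bb1` at `p = 5` BY THE μ-ROAD** (U₀-ns row of KT items
19202 / 19982; a SECOND per-row road beside the unit-twist record `TameUpperUnitTwistRecords.missingUpperBoundAt_g93100bb1_5`): the (t′) door `missingUpperBoundAt_five_tame_of_nonsplitCartanBasis_of_mu`
(fine-Selmer port of Kato 14.5 (3) ∘ (A) from the `μ`-hypotheses). KERNEL: `E[5]` irreducible, `Addv E 5`, `SubTprime E 5`
(`TameUpperUnitTwistRecords.irr_g93100bb1_5`, `TameUpperUnitTwistRecords.addv_g93100bb1_5`, `TameUpperUnitTwistRecords.subTprime_g93100bb1_5`, REUSED from the tree). DISPLAYED: the named facts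
`hKatoA hGZK hmod hCS`; Cremona's `r_an = 0` (`hr`); the `C_ns⁺(ε)` basis data (`e hε he σx σs hσx hσs`) and the SEVEN `μ`-hypotheses of `conjA_g93100bb1_5`. Per row; CONDITIONAL; nothing booked; BSD is not proved by this.
[cite: Kato2004Asterisque, Thm. 14.5 (3) (p. 236), Thm. 12.5 (3) (p. 222)] [cite: CoatesSujatha2005, Thm. 3.4 (§3)] [cite: Serre1972, §2.2] [cite: Miller2011LMS, Def. 1.1] [cite: Cremona2006, Table 1 (Cremona label 93100bb1)] -/
theorem missingUpperBoundAt_g93100bb1_5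
    (hKatoA : Kato2004.rankZero_padicValNat_sha_add_padicValNat_tamagawa_le_of_additive_potGood_of_irreducible_of_fineSelmerDual_fg)
    (hGZK : rank_eq_analyticRank_of_analyticRank_le_one) (hmod : hasEntireLFunction_rat)
    (hCS : CoatesSujatha2005.thm34_fineSelmerDual_moduleFinite_of_classicalMuVanishes_divisionField)
    {W : WeierstrassCurve ℚ} [W.IsElliptic] [W.IsGloballyMinimal] (hWeq : W = (⟨0, (-1), 0, 3092, (-91608)⟩ : WeierstrassCurve ℚ)) (hr : W.analyticRank = 0)
    (e : W.geomTorsion (5 : ℕ) ≃+ (Fin 2 → ZMod 5)) {ε : ZMod 5} (hε : ¬ IsSquare ε)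
    (he : ∀ σ : absoluteGaloisGroup ℚ, ∃ M ∈ nonsplitCartanNormalizer ε, ∀ P : W.geomTorsion (5 : ℕ), e (σ • P) = M *ᵥ e P)
    (σx σs : absoluteGaloisGroup ℚ) (hσx : ∀ P : W.geomTorsion (5 : ℕ), e (σx • P) = !![1, ε * (4 - ε); 4 - ε, 1] *ᵥ e P)
    (hσs : ∀ P : W.geomTorsion (5 : ℕ), e (σs • P) = !![1, 0; 0, 4] *ᵥ e P)
    (hμP : ∀ κE : ZpExtension ↥(fixedField (Subgroup.zpowers (absRestrictNormalHom (W.divisionField 5) σs))) 5,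
      κE.IsCyclotomic → ClassicalMuVanishes κE)
    (hμB₁ : ∀ κE : ZpExtension ↥(fixedField (Subgroup.zpowers (absRestrictNormalHom (W.divisionField 5) σx ^ 12) ⊔
        Subgroup.zpowers (absRestrictNormalHom (W.divisionField 5) σs))) 5,
      κE.IsCyclotomic → ClassicalMuVanishes κE)
    (hμB₁' : ∀ κE : ZpExtension ↥(fixedField (Subgroup.zpowers (absRestrictNormalHom (W.divisionField 5) σx ^ 6 *
        absRestrictNormalHom (W.divisionField 5) σs))) 5,
      κE.IsCyclotomic → ClassicalMuVanishes κE)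
    (hμS : ∀ κE : ZpExtension ↥(fixedField (Subgroup.zpowers (absRestrictNormalHom (W.divisionField 5) σx ^ 3))) 5,
      κE.IsCyclotomic → ClassicalMuVanishes κE)
    (hμB₂ : ∀ κE : ZpExtension ↥(fixedField (Subgroup.zpowers (absRestrictNormalHom (W.divisionField 5) σx ^ 6) ⊔
        Subgroup.zpowers (absRestrictNormalHom (W.divisionField 5) σs))) 5,
      κE.IsCyclotomic → ClassicalMuVanishes κE)
    (hμB₂' : ∀ κE : ZpExtension ↥(fixedField (Subgroup.zpowers (absRestrictNormalHom (W.divisionField 5) σx ^ 6) ⊔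
        Subgroup.zpowers (absRestrictNormalHom (W.divisionField 5) σx ^ 3 * absRestrictNormalHom (W.divisionField 5) σs))) 5,
      κE.IsCyclotomic → ClassicalMuVanishes κE)
    (hμB₃ : ∀ κE : ZpExtension ↥(fixedField (Subgroup.zpowers (absRestrictNormalHom (W.divisionField 5) σx ^ 3) ⊔
        Subgroup.zpowers (absRestrictNormalHom (W.divisionField 5) σs))) 5,
      κE.IsCyclotomic → ClassicalMuVanishes κE) :
    MissingUpperBoundAt W 5 := by
  subst hWeq
  haveI : Fact (Nat.Prime 5) := ⟨by norm_num⟩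
  exact CartanMuRoadDoorsTprimeFive.missingUpperBoundAt_five_tame_of_nonsplitCartanBasis_of_mu _ hKatoA hGZK hmod hCS hr
    TameUpperUnitTwistRecords.addv_g93100bb1_5 TameUpperUnitTwistRecords.subTprime_g93100bb1_5 TameUpperUnitTwistRecords.irr_g93100bb1_5
    e hε he σx σs hσx hσs hμP hμB₁ hμB₁' hμS hμB₂ hμB₂' hμB₃

/-! ### `100575h1` @ `p = 5` — `N = 100575 = 3^3·5^2·149`; Cremona: `r_an = 0`; (t′) at `5`: `e = 3` (Kodaira IV or IV*);
mod-`5` image normaliser of a NON-split Cartan `C_ns⁺(5)` (LMFDB `5Nn`) (census HOME/k8t-c4/KT-19413-anchor-census-g4.tsv / LMFDB); ♭ row (`5 ∤ ∏ c_ℓ`); U₀ unit-twist record and kernel lemmas in `…RecordsFlat27`.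
conjA-anchor g12 unit norm-index census (kit j307989, GRH for degree-24 class numbers unless CERT): `QP<s>=PASS:UNIT(s=2);B1<x^12,s>=PASS:UNIT(s=2);B1p<x^6 s>=PASS:UNIT(s=2);S<x^3>=PASS:UNIT(s=3);B2<x^6,s>=PASS:UNIT(s=2);B2p<x^6,x^3 s>=PASS:UNIT(s=2);B3<x^3,s>=PASS:UNIT(s=2)` ⇒ `CHAIN:PASS`. -/

/-- **RECORD — UPPER half `ord₅ #Ш(E) ≤ ord₅ #Ш(E)_an` for `E = 100575h1` at `p = 5` BY THE μ-ROAD** (U₀-ns row of KT items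
19202 / 19982; a SECOND per-row road beside the unit-twist record `TameUpperUnitTwistRecords.missingUpperBoundAt_g100575h1_5`): the (t′) door `missingUpperBoundAt_five_tame_of_nonsplitCartanBasis_of_mu`
(fine-Selmer port of Kato 14.5 (3) ∘ (A) from the `μ`-hypotheses). KERNEL: `E[5]` irreducible, `Addv E 5`, `SubTprime E 5`
(`TameUpperUnitTwistRecords.irr_g100575h1_5`, `TameUpperUnitTwistRecords.addv_g100575h1_5`, `TameUpperUnitTwistRecords.subTprime_g100575h1_5`, REUSED from the tree). DISPLAYED: the named facts
`hKatoA hGZK hmod hCS`; Cremona's `r_an = 0` (`hr`); the `C_ns⁺(ε)` basis data (`e hε he σx σs hσx hσs`) and the SEVEN `μ`-hypotheses of `conjA_g100575h1_5`. Per row; CONDITIONAL; nothing booked; BSD is not proved by this.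
[cite: Kato2004Asterisque, Thm. 14.5 (3) (p. 236), Thm. 12.5 (3) (p. 222)] [cite: CoatesSujatha2005, Thm. 3.4 (§3)] [cite: Serre1972, §2.2] [cite: Miller2011LMS, Def. 1.1] [cite: Cremona2006, Table 1 (Cremona label 100575h1)] -/
theorem missingUpperBoundAt_g100575h1_5
    (hKatoA : Kato2004.rankZero_padicValNat_sha_add_padicValNat_tamagawa_le_of_additive_potGood_of_irreducible_of_fineSelmerDual_fg)
    (hGZK : rank_eq_analyticRank_of_analyticRank_le_one) (hmod : hasEntireLFunction_rat)
    (hCS : CoatesSujatha2005.thm34_fineSelmerDual_moduleFinite_of_classicalMuVanishes_divisionField)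
    {W : WeierstrassCurve ℚ} [W.IsElliptic] [W.IsGloballyMinimal] (hWeq : W = (⟨1, (-1), 1, (-1206680), (-525469678)⟩ : WeierstrassCurve ℚ)) (hr : W.analyticRank = 0)
    (e : W.geomTorsion (5 : ℕ) ≃+ (Fin 2 → ZMod 5)) {ε : ZMod 5} (hε : ¬ IsSquare ε)
    (he : ∀ σ : absoluteGaloisGroup ℚ, ∃ M ∈ nonsplitCartanNormalizer ε, ∀ P : W.geomTorsion (5 : ℕ), e (σ • P) = M *ᵥ e P)
    (σx σs : absoluteGaloisGroup ℚ) (hσx : ∀ P : W.geomTorsion (5 : ℕ), e (σx • P) = !![1, ε * (4 - ε); 4 - ε, 1] *ᵥ e P)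
    (hσs : ∀ P : W.geomTorsion (5 : ℕ), e (σs • P) = !![1, 0; 0, 4] *ᵥ e P)
    (hμP : ∀ κE : ZpExtension ↥(fixedField (Subgroup.zpowers (absRestrictNormalHom (W.divisionField 5) σs))) 5,
      κE.IsCyclotomic → ClassicalMuVanishes κE)
    (hμB₁ : ∀ κE : ZpExtension ↥(fixedField (Subgroup.zpowers (absRestrictNormalHom (W.divisionField 5) σx ^ 12) ⊔
        Subgroup.zpowers (absRestrictNormalHom (W.divisionField 5) σs))) 5,
      κE.IsCyclotomic → ClassicalMuVanishes κE)
    (hμB₁' : ∀ κE : ZpExtension ↥(fixedField (Subgroup.zpowers (absRestrictNormalHom (W.divisionField 5) σx ^ 6 *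
        absRestrictNormalHom (W.divisionField 5) σs))) 5,
      κE.IsCyclotomic → ClassicalMuVanishes κE)
    (hμS : ∀ κE : ZpExtension ↥(fixedField (Subgroup.zpowers (absRestrictNormalHom (W.divisionField 5) σx ^ 3))) 5,
      κE.IsCyclotomic → ClassicalMuVanishes κE)
    (hμB₂ : ∀ κE : ZpExtension ↥(fixedField (Subgroup.zpowers (absRestrictNormalHom (W.divisionField 5) σx ^ 6) ⊔
        Subgroup.zpowers (absRestrictNormalHom (W.divisionField 5) σs))) 5,
      κE.IsCyclotomic → ClassicalMuVanishes κE)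
    (hμB₂' : ∀ κE : ZpExtension ↥(fixedField (Subgroup.zpowers (absRestrictNormalHom (W.divisionField 5) σx ^ 6) ⊔
        Subgroup.zpowers (absRestrictNormalHom (W.divisionField 5) σx ^ 3 * absRestrictNormalHom (W.divisionField 5) σs))) 5,
      κE.IsCyclotomic → ClassicalMuVanishes κE)
    (hμB₃ : ∀ κE : ZpExtension ↥(fixedField (Subgroup.zpowers (absRestrictNormalHom (W.divisionField 5) σx ^ 3) ⊔
        Subgroup.zpowers (absRestrictNormalHom (W.divisionField 5) σs))) 5,
      κE.IsCyclotomic → ClassicalMuVanishes κE) :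
    MissingUpperBoundAt W 5 := by
  subst hWeq
  haveI : Fact (Nat.Prime 5) := ⟨by norm_num⟩
  exact CartanMuRoadDoorsTprimeFive.missingUpperBoundAt_five_tame_of_nonsplitCartanBasis_of_mu _ hKatoA hGZK hmod hCS hr
    TameUpperUnitTwistRecords.addv_g100575h1_5 TameUpperUnitTwistRecords.subTprime_g100575h1_5 TameUpperUnitTwistRecords.irr_g100575h1_5
    e hε he σx σs hσx hσs hμP hμB₁ hμB₁' hμS hμB₂ hμB₂' hμB₃

/-! ### `100575k1` @ `p = 5` — `N = 100575 = 3^3·5^2·149`; Cremona: `r_an = 0`; (t′) at `5`: `e = 6` (Kodaira II or II*);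
mod-`5` image normaliser of a NON-split Cartan `C_ns⁺(5)` (LMFDB `5Nn`) (census HOME/k8t-c4/KT-19413-anchor-census-g4.tsv / LMFDB); ♭ row (`5 ∤ ∏ c_ℓ`); U₀ unit-twist record and kernel lemmas in `…RecordsFlat28`.
conjA-anchor g12 unit norm-index census (kit j307989, GRH for degree-24 class numbers unless CERT): `QP<s>=PASS:UNIT(s=2);B1<x^12,s>=PASS:UNIT(s=2);B1p<x^6 s>=PASS:UNIT(s=2);S<x^3>=PASS:UNIT(s=3);B2<x^6,s>=PASS:UNIT(s=2);B2p<x^6,x^3 s>=PASS:UNIT(s=2);B3<x^3,s>=PASS:UNIT(s=2)` ⇒ `CHAIN:PASS`. -/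

/-- **RECORD — UPPER half `ord₅ #Ш(E) ≤ ord₅ #Ш(E)_an` for `E = 100575k1` at `p = 5` BY THE μ-ROAD** (U₀-ns row of KT items
19202 / 19982; a SECOND per-row road beside the unit-twist record `TameUpperUnitTwistRecords.missingUpperBoundAt_g100575k1_5`): the (t′) door `missingUpperBoundAt_five_tame_of_nonsplitCartanBasis_of_mu`
(fine-Selmer port of Kato 14.5 (3) ∘ (A) from the `μ`-hypotheses). KERNEL: `E[5]` irreducible, `Addv E 5`, `SubTprime E 5`
(`TameUpperUnitTwistRecords.irr_g100575k1_5`, `TameUpperUnitTwistRecords.addv_g100575k1_5`, `TameUpperUnitTwistRecords.subTprime_g100575k1_5`, REUSED from the tree). DISPLAYED: the named facts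
`hKatoA hGZK hmod hCS`; Cremona's `r_an = 0` (`hr`); the `C_ns⁺(ε)` basis data (`e hε he σx σs hσx hσs`) and the SEVEN `μ`-hypotheses of `conjA_g100575k1_5`. Per row; CONDITIONAL; nothing booked; BSD is not proved by this.
[cite: Kato2004Asterisque, Thm. 14.5 (3) (p. 236), Thm. 12.5 (3) (p. 222)] [cite: CoatesSujatha2005, Thm. 3.4 (§3)] [cite: Serre1972, §2.2] [cite: Miller2011LMS, Def. 1.1] [cite: Cremona2006, Table 1 (Cremona label 100575k1)] -/
theorem missingUpperBoundAt_g100575k1_5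
    (hKatoA : Kato2004.rankZero_padicValNat_sha_add_padicValNat_tamagawa_le_of_additive_potGood_of_irreducible_of_fineSelmerDual_fg)
    (hGZK : rank_eq_analyticRank_of_analyticRank_le_one) (hmod : hasEntireLFunction_rat)
    (hCS : CoatesSujatha2005.thm34_fineSelmerDual_moduleFinite_of_classicalMuVanishes_divisionField)
    {W : WeierstrassCurve ℚ} [W.IsElliptic] [W.IsGloballyMinimal] (hWeq : W = (⟨1, (-1), 0, (-48267), (-4194104)⟩ : WeierstrassCurve ℚ)) (hr : W.analyticRank = 0)
    (e : W.geomTorsion (5 : ℕ) ≃+ (Fin 2 → ZMod 5)) {ε : ZMod 5} (hε : ¬ IsSquare ε)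
    (he : ∀ σ : absoluteGaloisGroup ℚ, ∃ M ∈ nonsplitCartanNormalizer ε, ∀ P : W.geomTorsion (5 : ℕ), e (σ • P) = M *ᵥ e P)
    (σx σs : absoluteGaloisGroup ℚ) (hσx : ∀ P : W.geomTorsion (5 : ℕ), e (σx • P) = !![1, ε * (4 - ε); 4 - ε, 1] *ᵥ e P)
    (hσs : ∀ P : W.geomTorsion (5 : ℕ), e (σs • P) = !![1, 0; 0, 4] *ᵥ e P)
    (hμP : ∀ κE : ZpExtension ↥(fixedField (Subgroup.zpowers (absRestrictNormalHom (W.divisionField 5) σs))) 5,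
      κE.IsCyclotomic → ClassicalMuVanishes κE)
    (hμB₁ : ∀ κE : ZpExtension ↥(fixedField (Subgroup.zpowers (absRestrictNormalHom (W.divisionField 5) σx ^ 12) ⊔
        Subgroup.zpowers (absRestrictNormalHom (W.divisionField 5) σs))) 5,
      κE.IsCyclotomic → ClassicalMuVanishes κE)
    (hμB₁' : ∀ κE : ZpExtension ↥(fixedField (Subgroup.zpowers (absRestrictNormalHom (W.divisionField 5) σx ^ 6 *
        absRestrictNormalHom (W.divisionField 5) σs))) 5,
      κE.IsCyclotomic → ClassicalMuVanishes κE)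
    (hμS : ∀ κE : ZpExtension ↥(fixedField (Subgroup.zpowers (absRestrictNormalHom (W.divisionField 5) σx ^ 3))) 5,
      κE.IsCyclotomic → ClassicalMuVanishes κE)
    (hμB₂ : ∀ κE : ZpExtension ↥(fixedField (Subgroup.zpowers (absRestrictNormalHom (W.divisionField 5) σx ^ 6) ⊔
        Subgroup.zpowers (absRestrictNormalHom (W.divisionField 5) σs))) 5,
      κE.IsCyclotomic → ClassicalMuVanishes κE)
    (hμB₂' : ∀ κE : ZpExtension ↥(fixedField (Subgroup.zpowers (absRestrictNormalHom (W.divisionField 5) σx ^ 6) ⊔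
        Subgroup.zpowers (absRestrictNormalHom (W.divisionField 5) σx ^ 3 * absRestrictNormalHom (W.divisionField 5) σs))) 5,
      κE.IsCyclotomic → ClassicalMuVanishes κE)
    (hμB₃ : ∀ κE : ZpExtension ↥(fixedField (Subgroup.zpowers (absRestrictNormalHom (W.divisionField 5) σx ^ 3) ⊔
        Subgroup.zpowers (absRestrictNormalHom (W.divisionField 5) σs))) 5,
      κE.IsCyclotomic → ClassicalMuVanishes κE) :
    MissingUpperBoundAt W 5 := by
  subst hWeq
  haveI : Fact (Nat.Prime 5) := ⟨by norm_num⟩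
  exact CartanMuRoadDoorsTprimeFive.missingUpperBoundAt_five_tame_of_nonsplitCartanBasis_of_mu _ hKatoA hGZK hmod hCS hr
    TameUpperUnitTwistRecords.addv_g100575k1_5 TameUpperUnitTwistRecords.subTprime_g100575k1_5 TameUpperUnitTwistRecords.irr_g100575k1_5
    e hε he σx σs hσx hσs hμP hμB₁ hμB₁' hμS hμB₂ hμB₂' hμB₃

/-! ### `100575q1` @ `p = 5` — `N = 100575 = 3^3·5^2·149`; Cremona: `r_an = 0`; (t′) at `5`: `e = 3` (Kodaira IV or IV*);
mod-`5` image normaliser of a NON-split Cartan `C_ns⁺(5)` (LMFDB `5Nn`) (census HOME/k8t-c4/KT-19413-anchor-census-g4.tsv / LMFDB); ♯ row (one Tamagawa carrier `q ∥ N` with `5 ∣ c_q`); NO unit-twist record (`ellrank`/`ellheegner`-undecided through census v13; kernel lemmas in THIS series).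
conjA-anchor g12 unit norm-index census (kit j307989, GRH for degree-24 class numbers unless CERT): `QP<s>=PASS:UNIT(s=2);B1<x^12,s>=PASS:UNIT(s=2);B1p<x^6 s>=PASS:UNIT(s=2);S<x^3>=PASS:UNIT(s=3);B2<x^6,s>=PASS:UNIT(s=2);B2p<x^6,x^3 s>=PASS:UNIT(s=2);B3<x^3,s>=PASS:UNIT(s=2)` ⇒ `CHAIN:PASS`. -/

/-- `[1, (-1), 0, (-10860117), 14198541416]` (Cremona's minimal model of `100575q1`, `N = 100575 = 3^3·5^2·149`) is an elliptic curve: `|Δ| = 3^11·5^8·149^5 ≠ 0`. [cite: Cremona2006, Table 1 (Cremona label 100575q1)] -/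
theorem isElliptic_g100575q1 : (⟨1, (-1), 0, (-10860117), 14198541416⟩ : WeierstrassCurve ℚ).IsElliptic :=
  isElliptic_of_discOf_ne_zero 1 (-1) 0 (-10860117) 14198541416 (by decide +kernel)

/-- `[1, (-1), 0, (-10860117), 14198541416]` (Cremona's minimal model of `100575q1`) is globally minimal: `|Δ| = 3^11·5^8·149^5` kernel-checked, Kraus' criterion prime by prime.
[cite: SilvermanAEC2009, VII.1 Remark 1.1] [cite: Kraus1989, Prop. 1 and Prop. 2] [cite: Cremona2006, Table 1 (Cremona label 100575q1)] -/
theorem isGloballyMinimal_g100575q1 : (⟨1, (-1), 0, (-10860117), 14198541416⟩ : WeierstrassCurve ℚ).IsGloballyMinimal :=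
  isGloballyMinimal_of_krausCriterion₃_factored 1 (-1) 0 (-10860117) 14198541416
    [(3, 11), (5, 8), (149, 5)] (by decide +kernel)
    (by intro qe hqe; simp only [List.mem_cons, List.not_mem_nil, or_false] at hqe
        rcases hqe with rfl | rfl | rfl <;> norm_num)
    (by set_option synthInstance.maxSize 2000 in decide +kernel)

/-- **`E[5]` IRREDUCIBLE for `E = 100575q1`** (kernel; Frobenius witness `ℓ = 7`: `#Ẽ(𝔽_{7}) = 3`, `a_{7} = 5`, `X² − (5)X + 7`
has no root mod `5`; `IntModel.hasIrreducibleModPGaloisRep_of_intModel_of_noroot`). [cite: Mazur1978, §6 Prop. 6.3 (1) (p. 153)]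
[cite: IrelandRosen1990, Prop. 5.1.2 and §8.1] [cite: Cremona2006, Table 1 (Cremona label 100575q1)] -/
theorem irr_g100575q1_5 : haveI : Fact (Nat.Prime 5) := ⟨by norm_num⟩; (⟨1, (-1), 0, (-10860117), 14198541416⟩ : WeierstrassCurve ℚ).HasIrreducibleModPGaloisRep 5 := by
  have hnr : ∀ t : ZMod 5, t ^ 2 - ((((7 : ℕ) : ℤ) + 1 - ((3 : ℕ) : ℤ) : ℤ) : ZMod 5) * t + ((7 : ℕ) : ZMod 5) ≠ 0 := by
    decide
  haveI := isElliptic_g100575q1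
  haveI := isGloballyMinimal_g100575q1
  haveI : Fact (Nat.Prime 5) := ⟨by norm_num⟩
  haveI : Fact (Nat.Prime 7) := ⟨by norm_num⟩
  have hI : integralModelInt (⟨1, (-1), 0, (-10860117), 14198541416⟩ : WeierstrassCurve ℚ) = (⟨1, (-1), 0, (-10860117), 14198541416⟩ : WeierstrassCurve ℤ) :=
    integralModelInt_eq_of_map_eq _ (map_mk_int 1 (-1) 0 (-10860117) 14198541416)
  have hc : Nat.card (((((⟨1, (-1), 0, (-10860117), 14198541416⟩ : WeierstrassCurve ℤ))).map (Int.castRingHom (ZMod 7))).toAffine.Point) = 3 := by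
    have h := natCard_point_eq_countPoints 1 (-1) 0 (-10860117) 14198541416 7 (by norm_num) (by decide +kernel)
    have h' : countPoints [1, (-1), 0, (-10860117), 14198541416] 7 = 3 := countPoints_eq_of_fast (by decide +kernel)
    exact_mod_cast h.trans h'
  exact hasIrreducibleModPGaloisRep_of_intModel_of_noroot hI 5 7 (by norm_num) (by decide +kernel) hc hnr

/-- **`100575q1` is ADDITIVE at `5`** (kernel: `5 ∣ Δ`, `5 ∣ c₄` on the minimal model; `Additive.addv_of_intModel`).
[cite: SilvermanAEC2009, VII.5 Prop. 5.1 (c)] [cite: Cremona2006, Table 1 (Cremona label 100575q1)] -/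
theorem addv_g100575q1_5 : haveI := isElliptic_g100575q1; haveI := isGloballyMinimal_g100575q1; haveI : Fact (Nat.Prime 5) := ⟨by norm_num⟩; Addv (⟨1, (-1), 0, (-10860117), 14198541416⟩ : WeierstrassCurve ℚ) 5 := by
  haveI := isElliptic_g100575q1
  haveI := isGloballyMinimal_g100575q1
  haveI : Fact (Nat.Prime 5) := ⟨by norm_num⟩
  have hI : integralModelInt (⟨1, (-1), 0, (-10860117), 14198541416⟩ : WeierstrassCurve ℚ) = (⟨1, (-1), 0, (-10860117), 14198541416⟩ : WeierstrassCurve ℤ) :=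
    integralModelInt_eq_of_map_eq _ (map_mk_int 1 (-1) 0 (-10860117) 14198541416)
  exact Additive.addv_of_intModel hI 5 (by decide +kernel) (by decide +kernel)

/-- **`ord_5 j(E) ≥ 0` for `E = 100575q1`** (kernel: `5^4 ∣ c₄`, `5^9 ∤ Δ`, `8 ≤ 3·4` on the minimal model;
`padicValRat_j_nonneg_of_intModel`) — potentially good reduction at `5`. [cite: SilvermanAEC2009, VII.5 Prop. 5.5] [cite: Cremona2006, Table 1 (Cremona label 100575q1)] -/
theorem jint_g100575q1_5 : haveI := isElliptic_g100575q1; 0 ≤ padicValRat 5 (⟨1, (-1), 0, (-10860117), 14198541416⟩ : WeierstrassCurve ℚ).j := by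
  haveI := isElliptic_g100575q1
  haveI := isGloballyMinimal_g100575q1
  haveI : Fact (Nat.Prime 5) := ⟨by norm_num⟩
  have hI : integralModelInt (⟨1, (-1), 0, (-10860117), 14198541416⟩ : WeierstrassCurve ℚ) = (⟨1, (-1), 0, (-10860117), 14198541416⟩ : WeierstrassCurve ℤ) :=
    integralModelInt_eq_of_map_eq _ (map_mk_int 1 (-1) 0 (-10860117) 14198541416)
  exact TameUpperUnitTwistRecords.padicValRat_j_nonneg_of_intModel hI 5 (a := 4) (b := 8) (by decide +kernel) (by decide +kernel) (by norm_num)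

/-- **`100575q1` lies on the census cell (t′) at `p = 5`** (kernel: `SubTprime` = not potentially multiplicative (`jint_g100575q1_5`),
`f_5 = 2` (automatic at an additive `p ≥ 5`), semistability index `e = 12/gcd(12, ord_5 Δ) = 12/gcd(12,8) = 3 ∤ 5 − 1`;
`subTprime_of_intModel`). [cite: SilvermanATAEC1994, IV.10.4] [cite: Delbourgo1998, §1.5] [cite: Cremona2006, Table 1 (Cremona label 100575q1)] -/
theorem subTprime_g100575q1_5 : haveI := isElliptic_g100575q1; haveI := isGloballyMinimal_g100575q1; haveI : Fact (Nat.Prime 5) := ⟨by norm_num⟩; SubTprime (⟨1, (-1), 0, (-10860117), 14198541416⟩ : WeierstrassCurve ℚ) 5 := by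
  haveI := isElliptic_g100575q1
  haveI := isGloballyMinimal_g100575q1
  haveI : Fact (Nat.Prime 5) := ⟨by norm_num⟩
  have hI : integralModelInt (⟨1, (-1), 0, (-10860117), 14198541416⟩ : WeierstrassCurve ℚ) = (⟨1, (-1), 0, (-10860117), 14198541416⟩ : WeierstrassCurve ℤ) :=
    integralModelInt_eq_of_map_eq _ (map_mk_int 1 (-1) 0 (-10860117) 14198541416)
  exact TameUpperUnitTwistRecords.subTprime_of_intModel hI 5 (by norm_num) addv_g100575q1_5 jint_g100575q1_5 (b := 8) (by decide +kernel) (by decide +kernel)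
    (by decide)

/-- **RECORD — UPPER half `ord₅ #Ш(E) ≤ ord₅ #Ш(E)_an` for `E = 100575q1` at `p = 5` BY THE μ-ROAD** (U₀-ns row of KT items
19202 / 19982; the FIRST U₀ record of this row (no unit twist certified through census v13)): the (t′) door `missingUpperBoundAt_five_tame_of_nonsplitCartanBasis_of_mu`
(fine-Selmer port of Kato 14.5 (3) ∘ (A) from the `μ`-hypotheses). KERNEL: `E[5]` irreducible, `Addv E 5`, `SubTprime E 5`
(`irr_g100575q1_5`, `addv_g100575q1_5`, `subTprime_g100575q1_5`). DISPLAYED: the named facts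
`hKatoA hGZK hmod hCS`; Cremona's `r_an = 0` (`hr`); the `C_ns⁺(ε)` basis data (`e hε he σx σs hσx hσs`) and the SEVEN `μ`-hypotheses of `conjA_g100575q1_5`. Per row; CONDITIONAL; nothing booked; BSD is not proved by this.
[cite: Kato2004Asterisque, Thm. 14.5 (3) (p. 236), Thm. 12.5 (3) (p. 222)] [cite: CoatesSujatha2005, Thm. 3.4 (§3)] [cite: Serre1972, §2.2] [cite: Miller2011LMS, Def. 1.1] [cite: Cremona2006, Table 1 (Cremona label 100575q1)] -/
theorem missingUpperBoundAt_g100575q1_5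
    (hKatoA : Kato2004.rankZero_padicValNat_sha_add_padicValNat_tamagawa_le_of_additive_potGood_of_irreducible_of_fineSelmerDual_fg)
    (hGZK : rank_eq_analyticRank_of_analyticRank_le_one) (hmod : hasEntireLFunction_rat)
    (hCS : CoatesSujatha2005.thm34_fineSelmerDual_moduleFinite_of_classicalMuVanishes_divisionField)
    {W : WeierstrassCurve ℚ} [W.IsElliptic] [W.IsGloballyMinimal] (hWeq : W = (⟨1, (-1), 0, (-10860117), 14198541416⟩ : WeierstrassCurve ℚ)) (hr : W.analyticRank = 0)
    (e : W.geomTorsion (5 : ℕ) ≃+ (Fin 2 → ZMod 5)) {ε : ZMod 5} (hε : ¬ IsSquare ε)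
    (he : ∀ σ : absoluteGaloisGroup ℚ, ∃ M ∈ nonsplitCartanNormalizer ε, ∀ P : W.geomTorsion (5 : ℕ), e (σ • P) = M *ᵥ e P)
    (σx σs : absoluteGaloisGroup ℚ) (hσx : ∀ P : W.geomTorsion (5 : ℕ), e (σx • P) = !![1, ε * (4 - ε); 4 - ε, 1] *ᵥ e P)
    (hσs : ∀ P : W.geomTorsion (5 : ℕ), e (σs • P) = !![1, 0; 0, 4] *ᵥ e P)
    (hμP : ∀ κE : ZpExtension ↥(fixedField (Subgroup.zpowers (absRestrictNormalHom (W.divisionField 5) σs))) 5,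
      κE.IsCyclotomic → ClassicalMuVanishes κE)
    (hμB₁ : ∀ κE : ZpExtension ↥(fixedField (Subgroup.zpowers (absRestrictNormalHom (W.divisionField 5) σx ^ 12) ⊔
        Subgroup.zpowers (absRestrictNormalHom (W.divisionField 5) σs))) 5,
      κE.IsCyclotomic → ClassicalMuVanishes κE)
    (hμB₁' : ∀ κE : ZpExtension ↥(fixedField (Subgroup.zpowers (absRestrictNormalHom (W.divisionField 5) σx ^ 6 *
        absRestrictNormalHom (W.divisionField 5) σs))) 5,
      κE.IsCyclotomic → ClassicalMuVanishes κE)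
    (hμS : ∀ κE : ZpExtension ↥(fixedField (Subgroup.zpowers (absRestrictNormalHom (W.divisionField 5) σx ^ 3))) 5,
      κE.IsCyclotomic → ClassicalMuVanishes κE)
    (hμB₂ : ∀ κE : ZpExtension ↥(fixedField (Subgroup.zpowers (absRestrictNormalHom (W.divisionField 5) σx ^ 6) ⊔
        Subgroup.zpowers (absRestrictNormalHom (W.divisionField 5) σs))) 5,
      κE.IsCyclotomic → ClassicalMuVanishes κE)
    (hμB₂' : ∀ κE : ZpExtension ↥(fixedField (Subgroup.zpowers (absRestrictNormalHom (W.divisionField 5) σx ^ 6) ⊔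
        Subgroup.zpowers (absRestrictNormalHom (W.divisionField 5) σx ^ 3 * absRestrictNormalHom (W.divisionField 5) σs))) 5,
      κE.IsCyclotomic → ClassicalMuVanishes κE)
    (hμB₃ : ∀ κE : ZpExtension ↥(fixedField (Subgroup.zpowers (absRestrictNormalHom (W.divisionField 5) σx ^ 3) ⊔
        Subgroup.zpowers (absRestrictNormalHom (W.divisionField 5) σs))) 5,
      κE.IsCyclotomic → ClassicalMuVanishes κE) :
    MissingUpperBoundAt W 5 := by
  subst hWeq
  haveI : Fact (Nat.Prime 5) := ⟨by norm_num⟩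
  exact CartanMuRoadDoorsTprimeFive.missingUpperBoundAt_five_tame_of_nonsplitCartanBasis_of_mu _ hKatoA hGZK hmod hCS hr
    addv_g100575q1_5 subTprime_g100575q1_5 irr_g100575q1_5
    e hε he σx σs hσx hσs hμP hμB₁ hμB₁' hμS hμB₂ hμB₂' hμB₃

/-! ### `101925o1` @ `p = 5` — `N = 101925 = 3^3·5^2·151`; Cremona: `r_an = 0`; (t′) at `5`: `e = 3` (Kodaira IV or IV*);
mod-`5` image normaliser of a NON-split Cartan `C_ns⁺(5)` (LMFDB `5Nn`) (census HOME/k8t-c4/KT-19413-anchor-census-g4.tsv / LMFDB); ♭ row (`5 ∤ ∏ c_ℓ`); U₀ unit-twist record and kernel lemmas in `…RecordsFlat81`.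
conjA-anchor g12 unit norm-index census (kit j307989, GRH for degree-24 class numbers unless CERT): `QP<s>=PASS:UNIT(s=2);B1<x^12,s>=PASS:UNIT(s=2);B1p<x^6 s>=PASS:UNIT(s=2);S<x^3>=PASS:UNIT(s=3);B2<x^6,s>=PASS:UNIT(s=2);B2p<x^6,x^3 s>=PASS:UNIT(s=2);B3<x^3,s>=PASS:UNIT(s=2)` ⇒ `CHAIN:PASS`. -/

/-- **RECORD — UPPER half `ord₅ #Ш(E) ≤ ord₅ #Ш(E)_an` for `E = 101925o1` at `p = 5` BY THE μ-ROAD** (U₀-ns row of KT items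
19202 / 19982; a SECOND per-row road beside the unit-twist record `TameUpperUnitTwistRecords.missingUpperBoundAt_g101925o1_5`): the (t′) door `missingUpperBoundAt_five_tame_of_nonsplitCartanBasis_of_mu`
(fine-Selmer port of Kato 14.5 (3) ∘ (A) from the `μ`-hypotheses). KERNEL: `E[5]` irreducible, `Addv E 5`, `SubTprime E 5`
(`TameUpperUnitTwistRecords.irr_g101925o1_5`, `TameUpperUnitTwistRecords.addv_g101925o1_5`, `TameUpperUnitTwistRecords.subTprime_g101925o1_5`, REUSED from the tree). DISPLAYED: the named facts
`hKatoA hGZK hmod hCS`; Cremona's `r_an = 0` (`hr`); the `C_ns⁺(ε)` basis data (`e hε he σx σs hσx hσs`) and the SEVEN `μ`-hypotheses of `conjA_g101925o1_5`. Per row; CONDITIONAL; nothing booked; BSD is not proved by this.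
[cite: Kato2004Asterisque, Thm. 14.5 (3) (p. 236), Thm. 12.5 (3) (p. 222)] [cite: CoatesSujatha2005, Thm. 3.4 (§3)] [cite: Serre1972, §2.2] [cite: Miller2011LMS, Def. 1.1] [cite: Cremona2006, Table 1 (Cremona label 101925o1)] -/
theorem missingUpperBoundAt_g101925o1_5
    (hKatoA : Kato2004.rankZero_padicValNat_sha_add_padicValNat_tamagawa_le_of_additive_potGood_of_irreducible_of_fineSelmerDual_fg)
    (hGZK : rank_eq_analyticRank_of_analyticRank_le_one) (hmod : hasEntireLFunction_rat)
    (hCS : CoatesSujatha2005.thm34_fineSelmerDual_moduleFinite_of_classicalMuVanishes_divisionField)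
    {W : WeierstrassCurve ℚ} [W.IsElliptic] [W.IsGloballyMinimal] (hWeq : W = (⟨1, (-1), 1, (-426680), 98042822⟩ : WeierstrassCurve ℚ)) (hr : W.analyticRank = 0)
    (e : W.geomTorsion (5 : ℕ) ≃+ (Fin 2 → ZMod 5)) {ε : ZMod 5} (hε : ¬ IsSquare ε)
    (he : ∀ σ : absoluteGaloisGroup ℚ, ∃ M ∈ nonsplitCartanNormalizer ε, ∀ P : W.geomTorsion (5 : ℕ), e (σ • P) = M *ᵥ e P)
    (σx σs : absoluteGaloisGroup ℚ) (hσx : ∀ P : W.geomTorsion (5 : ℕ), e (σx • P) = !![1, ε * (4 - ε); 4 - ε, 1] *ᵥ e P)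
    (hσs : ∀ P : W.geomTorsion (5 : ℕ), e (σs • P) = !![1, 0; 0, 4] *ᵥ e P)
    (hμP : ∀ κE : ZpExtension ↥(fixedField (Subgroup.zpowers (absRestrictNormalHom (W.divisionField 5) σs))) 5,
      κE.IsCyclotomic → ClassicalMuVanishes κE)
    (hμB₁ : ∀ κE : ZpExtension ↥(fixedField (Subgroup.zpowers (absRestrictNormalHom (W.divisionField 5) σx ^ 12) ⊔
        Subgroup.zpowers (absRestrictNormalHom (W.divisionField 5) σs))) 5,
      κE.IsCyclotomic → ClassicalMuVanishes κE)
    (hμB₁' : ∀ κE : ZpExtension ↥(fixedField (Subgroup.zpowers (absRestrictNormalHom (W.divisionField 5) σx ^ 6 *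
        absRestrictNormalHom (W.divisionField 5) σs))) 5,
      κE.IsCyclotomic → ClassicalMuVanishes κE)
    (hμS : ∀ κE : ZpExtension ↥(fixedField (Subgroup.zpowers (absRestrictNormalHom (W.divisionField 5) σx ^ 3))) 5,
      κE.IsCyclotomic → ClassicalMuVanishes κE)
    (hμB₂ : ∀ κE : ZpExtension ↥(fixedField (Subgroup.zpowers (absRestrictNormalHom (W.divisionField 5) σx ^ 6) ⊔
        Subgroup.zpowers (absRestrictNormalHom (W.divisionField 5) σs))) 5,
      κE.IsCyclotomic → ClassicalMuVanishes κE)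
    (hμB₂' : ∀ κE : ZpExtension ↥(fixedField (Subgroup.zpowers (absRestrictNormalHom (W.divisionField 5) σx ^ 6) ⊔
        Subgroup.zpowers (absRestrictNormalHom (W.divisionField 5) σx ^ 3 * absRestrictNormalHom (W.divisionField 5) σs))) 5,
      κE.IsCyclotomic → ClassicalMuVanishes κE)
    (hμB₃ : ∀ κE : ZpExtension ↥(fixedField (Subgroup.zpowers (absRestrictNormalHom (W.divisionField 5) σx ^ 3) ⊔
        Subgroup.zpowers (absRestrictNormalHom (W.divisionField 5) σs))) 5,
      κE.IsCyclotomic → ClassicalMuVanishes κE) :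
    MissingUpperBoundAt W 5 := by
  subst hWeq
  haveI : Fact (Nat.Prime 5) := ⟨by norm_num⟩
  exact CartanMuRoadDoorsTprimeFive.missingUpperBoundAt_five_tame_of_nonsplitCartanBasis_of_mu _ hKatoA hGZK hmod hCS hr
    TameUpperUnitTwistRecords.addv_g101925o1_5 TameUpperUnitTwistRecords.subTprime_g101925o1_5 TameUpperUnitTwistRecords.irr_g101925o1_5
    e hε he σx σs hσx hσs hμP hμB₁ hμB₁' hμS hμB₂ hμB₂' hμB₃

/-! ### `101925r1` @ `p = 5` — `N = 101925 = 3^3·5^2·151`; Cremona: `r_an = 0`; (t′) at `5`: `e = 6` (Kodaira II or II*);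
mod-`5` image normaliser of a NON-split Cartan `C_ns⁺(5)` (LMFDB `5Nn`) (census HOME/k8t-c4/KT-19413-anchor-census-g4.tsv / LMFDB); ♭ row (`5 ∤ ∏ c_ℓ`); U₀ unit-twist record and kernel lemmas in `…RecordsFlat81`.
conjA-anchor g12 unit norm-index census (kit j307989, GRH for degree-24 class numbers unless CERT): `QP<s>=PASS:UNIT(s=2);B1<x^12,s>=PASS:UNIT(s=2);B1p<x^6 s>=PASS:UNIT(s=2);S<x^3>=PASS:UNIT(s=3);B2<x^6,s>=PASS:UNIT(s=2);B2p<x^6,x^3 s>=PASS:UNIT(s=2);B3<x^3,s>=PASS:UNIT(s=2)` ⇒ `CHAIN:PASS`. -/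

/-- **RECORD — UPPER half `ord₅ #Ш(E) ≤ ord₅ #Ш(E)_an` for `E = 101925r1` at `p = 5` BY THE μ-ROAD** (U₀-ns row of KT items
19202 / 19982; a SECOND per-row road beside the unit-twist record `TameUpperUnitTwistRecords.missingUpperBoundAt_g101925r1_5`): the (t′) door `missingUpperBoundAt_five_tame_of_nonsplitCartanBasis_of_mu`
(fine-Selmer port of Kato 14.5 (3) ∘ (A) from the `μ`-hypotheses). KERNEL: `E[5]` irreducible, `Addv E 5`, `SubTprime E 5`
(`TameUpperUnitTwistRecords.irr_g101925r1_5`, `TameUpperUnitTwistRecords.addv_g101925r1_5`, `TameUpperUnitTwistRecords.subTprime_g101925r1_5`, REUSED from the tree). DISPLAYED: the named facts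
`hKatoA hGZK hmod hCS`; Cremona's `r_an = 0` (`hr`); the `C_ns⁺(ε)` basis data (`e hε he σx σs hσx hσs`) and the SEVEN `μ`-hypotheses of `conjA_g101925r1_5`. Per row; CONDITIONAL; nothing booked; BSD is not proved by this.
[cite: Kato2004Asterisque, Thm. 14.5 (3) (p. 236), Thm. 12.5 (3) (p. 222)] [cite: CoatesSujatha2005, Thm. 3.4 (§3)] [cite: Serre1972, §2.2] [cite: Miller2011LMS, Def. 1.1] [cite: Cremona2006, Table 1 (Cremona label 101925r1)] -/
theorem missingUpperBoundAt_g101925r1_5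
    (hKatoA : Kato2004.rankZero_padicValNat_sha_add_padicValNat_tamagawa_le_of_additive_potGood_of_irreducible_of_fineSelmerDual_fg)
    (hGZK : rank_eq_analyticRank_of_analyticRank_le_one) (hmod : hasEntireLFunction_rat)
    (hCS : CoatesSujatha2005.thm34_fineSelmerDual_moduleFinite_of_classicalMuVanishes_divisionField)
    {W : WeierstrassCurve ℚ} [W.IsElliptic] [W.IsGloballyMinimal] (hWeq : W = (⟨1, (-1), 0, (-17067), 787756⟩ : WeierstrassCurve ℚ)) (hr : W.analyticRank = 0)
    (e : W.geomTorsion (5 : ℕ) ≃+ (Fin 2 → ZMod 5)) {ε : ZMod 5} (hε : ¬ IsSquare ε)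
    (he : ∀ σ : absoluteGaloisGroup ℚ, ∃ M ∈ nonsplitCartanNormalizer ε, ∀ P : W.geomTorsion (5 : ℕ), e (σ • P) = M *ᵥ e P)
    (σx σs : absoluteGaloisGroup ℚ) (hσx : ∀ P : W.geomTorsion (5 : ℕ), e (σx • P) = !![1, ε * (4 - ε); 4 - ε, 1] *ᵥ e P)
    (hσs : ∀ P : W.geomTorsion (5 : ℕ), e (σs • P) = !![1, 0; 0, 4] *ᵥ e P)
    (hμP : ∀ κE : ZpExtension ↥(fixedField (Subgroup.zpowers (absRestrictNormalHom (W.divisionField 5) σs))) 5,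
      κE.IsCyclotomic → ClassicalMuVanishes κE)
    (hμB₁ : ∀ κE : ZpExtension ↥(fixedField (Subgroup.zpowers (absRestrictNormalHom (W.divisionField 5) σx ^ 12) ⊔
        Subgroup.zpowers (absRestrictNormalHom (W.divisionField 5) σs))) 5,
      κE.IsCyclotomic → ClassicalMuVanishes κE)
    (hμB₁' : ∀ κE : ZpExtension ↥(fixedField (Subgroup.zpowers (absRestrictNormalHom (W.divisionField 5) σx ^ 6 *
        absRestrictNormalHom (W.divisionField 5) σs))) 5,
      κE.IsCyclotomic → ClassicalMuVanishes κE)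
    (hμS : ∀ κE : ZpExtension ↥(fixedField (Subgroup.zpowers (absRestrictNormalHom (W.divisionField 5) σx ^ 3))) 5,
      κE.IsCyclotomic → ClassicalMuVanishes κE)
    (hμB₂ : ∀ κE : ZpExtension ↥(fixedField (Subgroup.zpowers (absRestrictNormalHom (W.divisionField 5) σx ^ 6) ⊔
        Subgroup.zpowers (absRestrictNormalHom (W.divisionField 5) σs))) 5,
      κE.IsCyclotomic → ClassicalMuVanishes κE)
    (hμB₂' : ∀ κE : ZpExtension ↥(fixedField (Subgroup.zpowers (absRestrictNormalHom (W.divisionField 5) σx ^ 6) ⊔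
        Subgroup.zpowers (absRestrictNormalHom (W.divisionField 5) σx ^ 3 * absRestrictNormalHom (W.divisionField 5) σs))) 5,
      κE.IsCyclotomic → ClassicalMuVanishes κE)
    (hμB₃ : ∀ κE : ZpExtension ↥(fixedField (Subgroup.zpowers (absRestrictNormalHom (W.divisionField 5) σx ^ 3) ⊔
        Subgroup.zpowers (absRestrictNormalHom (W.divisionField 5) σs))) 5,
      κE.IsCyclotomic → ClassicalMuVanishes κE) :
    MissingUpperBoundAt W 5 := by
  subst hWeq
  haveI : Fact (Nat.Prime 5) := ⟨by norm_num⟩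
  exact CartanMuRoadDoorsTprimeFive.missingUpperBoundAt_five_tame_of_nonsplitCartanBasis_of_mu _ hKatoA hGZK hmod hCS hr
    TameUpperUnitTwistRecords.addv_g101925r1_5 TameUpperUnitTwistRecords.subTprime_g101925r1_5 TameUpperUnitTwistRecords.irr_g101925r1_5
    e hε he σx σs hσx hσs hμP hμB₁ hμB₁' hμS hμB₂ hμB₂' hμB₃

end Summit.BirchSwinnertonDyer.BirchSwinnertonDyer.Theorems.TameConjAFiveRecords

end
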